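import Literature.NumberTheory.LFunctions.WeilTwoPrimeDeflL2Def
import Literature.NumberTheory.LFunctions.WeilTwoPrimeDeflL2DataPO24
import Literature.NumberTheory.LFunctions.WeilBlockRowsR
import HarnessLib

/-!
# Deflated two-prime certificate L2: the materialized odd block agrees with `P_r + Σ μ ĉ ĉᵀ`, rows 90–99

`WeilCert.checkPmRowG` for certificate L2 (odd block), by `decide +kernel`. Pure proof file; nothing is asserted.
-/

noncomputable section

namespace Literature.NumberTheory.LFunctions

set_option maxHeartbeats 0 in
/-- Row 90 of the materialized odd block is row 90 of `P_r + Σ μ ĉ ĉᵀ` (certificate L2). [folklore] -/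
theorem checkPmRowG1_90_weilCertDeflL2 : weilCertDeflL2Base.checkPmRowG weilCertDeflL2P weilCertDeflL2PmO 1 90 = true := by
  decide +kernel

set_option maxHeartbeats 0 in
/-- Row 91 of the materialized odd block is row 91 of `P_r + Σ μ ĉ ĉᵀ` (certificate L2). [folklore] -/
theorem checkPmRowG1_91_weilCertDeflL2 : weilCertDeflL2Base.checkPmRowG weilCertDeflL2P weilCertDeflL2PmO 1 91 = true := by
  decide +kernel

set_option maxHeartbeats 0 in
/-- Row 92 of the materialized odd block is row 92 of `P_r + Σ μ ĉ ĉᵀ` (certificate L2). [folklore] -/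
theorem checkPmRowG1_92_weilCertDeflL2 : weilCertDeflL2Base.checkPmRowG weilCertDeflL2P weilCertDeflL2PmO 1 92 = true := by
  decide +kernel

set_option maxHeartbeats 0 in
/-- Row 93 of the materialized odd block is row 93 of `P_r + Σ μ ĉ ĉᵀ` (certificate L2). [folklore] -/
theorem checkPmRowG1_93_weilCertDeflL2 : weilCertDeflL2Base.checkPmRowG weilCertDeflL2P weilCertDeflL2PmO 1 93 = true := by
  decide +kernel

set_option maxHeartbeats 0 in
/-- Row 94 of the materialized odd block is row 94 of `P_r + Σ μ ĉ ĉᵀ` (certificate L2). [folklore] -/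
theorem checkPmRowG1_94_weilCertDeflL2 : weilCertDeflL2Base.checkPmRowG weilCertDeflL2P weilCertDeflL2PmO 1 94 = true := by
  decide +kernel

set_option maxHeartbeats 0 in
/-- Row 95 of the materialized odd block is row 95 of `P_r + Σ μ ĉ ĉᵀ` (certificate L2). [folklore] -/
theorem checkPmRowG1_95_weilCertDeflL2 : weilCertDeflL2Base.checkPmRowG weilCertDeflL2P weilCertDeflL2PmO 1 95 = true := by
  decide +kernel

set_option maxHeartbeats 0 in
/-- Row 96 of the materialized odd block is row 96 of `P_r + Σ μ ĉ ĉᵀ` (certificate L2). [folklore] -/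
theorem checkPmRowG1_96_weilCertDeflL2 : weilCertDeflL2Base.checkPmRowG weilCertDeflL2P weilCertDeflL2PmO 1 96 = true := by
  decide +kernel

set_option maxHeartbeats 0 in
/-- Row 97 of the materialized odd block is row 97 of `P_r + Σ μ ĉ ĉᵀ` (certificate L2). [folklore] -/
theorem checkPmRowG1_97_weilCertDeflL2 : weilCertDeflL2Base.checkPmRowG weilCertDeflL2P weilCertDeflL2PmO 1 97 = true := by
  decide +kernel

set_option maxHeartbeats 0 in
/-- Row 98 of the materialized odd block is row 98 of `P_r + Σ μ ĉ ĉᵀ` (certificate L2). [folklore] -/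
theorem checkPmRowG1_98_weilCertDeflL2 : weilCertDeflL2Base.checkPmRowG weilCertDeflL2P weilCertDeflL2PmO 1 98 = true := by
  decide +kernel

set_option maxHeartbeats 0 in
/-- Row 99 of the materialized odd block is row 99 of `P_r + Σ μ ĉ ĉᵀ` (certificate L2). [folklore] -/
theorem checkPmRowG1_99_weilCertDeflL2 : weilCertDeflL2Base.checkPmRowG weilCertDeflL2P weilCertDeflL2PmO 1 99 = true := by
  decide +kernel


end Literature.NumberTheory.LFunctions
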